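import Summits.AnomalousDissipation.AnomalousDissipation.Theorems.SawtoothPulseCascadeK1LocalisedCascadeFlatShellOsc
import Summits.AnomalousDissipation.AnomalousDissipation.Theorems.SawtoothPulseCascadeK1LocalisedCascadeLedgerFeedChain

/-!
# K1loc — THE CAP OF THE FLAT SHELL (composition): `√A′_{i+1}(X) ≤ √J_{A′} + √J_{B′} + 𝔞 + √f_{B′} + √f_{A′}`

Prover lane on the crux `K1LocalisedCascade` (stmt-AnomalousDissipation-19491), route `SawtoothPulseCascade`
(S-B/S-C assembly seat; the LEDGER ASSEMBLY, thin tail).  `…FlatShellOsc.flatShell_vstep_osc_le` (A′-V at `X`) and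
`flatShallow_hstep_osc_le` (B′-H at `Y`) composed by `…LedgerFeedChain.sqrt_offCone_next_le`: with a cap `√A_i(Y) ≤ 𝔞` of the FAT shell
`A_i(Y) = Σ'[Y ≤ |k₀| ∧ |k₀| ≤ 2|k₁|]‖𝓕a_i‖²` (e.g. from `…ShellChainOsc.sqrt_shell_le_far_add_sum_osc` at threshold `Y`), the flat shell of
the next iterate satisfies `√(Σ'[X ≤ |k₀| ∧ 2|k₀| ≤ 15|k₁|]‖𝓕a_{i+1}‖²) ≤ √J_{A′}(i,X) + √J_{B′}(i,Y) + 𝔞 + √f_{B′} + √f_{A′}` — the amplitude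
`𝔞′` consumed by the thin (C-H) window (`…PhaseStepThin`, `X = Y_C = 2002k`, `Y = 88k`).
No definitions; no statement about the crux. [cite: Grafakos2014, Prop. 3.1.2 (5), Prop. 3.2.7 (3), §3.1.3] [problem: turb]
-/

-- `Summit.<Summit>.<Problem>`: single-conjunct summit, the duplicate namespace segment is deliberate.
set_option linter.dupNamespace false

noncomputable section

namespace Summit.AnomalousDissipation.AnomalousDissipation.Theorems.SawtoothPulseCascade.K1Window

open MeasureTheory Set Filter Topology UnitAddTorus Function Complex Metric
open scoped Real ENNReal
open Literature.Analysis Literature.Analysis.FunctionSpaces Literature.Analysis.FunctionSpaces.Torus Literature.Analysis.FluidPDE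
open Literature.Analysis.FluidPDE.ShearStage
open Literature.Analysis.FluidPDE.SawtoothCascade Literature.Analysis.FluidPDE.SawtoothCascade.CascadeParams
open Summit.AnomalousDissipation.AnomalousDissipation.Theorems.SawtoothPulseCascade.K1Start
open Summit.AnomalousDissipation.AnomalousDissipation.Theorems.SawtoothPulseCascade.K1Flat
open Summit.AnomalousDissipation.AnomalousDissipation.Theorems.SawtoothPulseCascade.K1Ledger.From

section Cascade

variable (P : CascadeParams)

set_option maxHeartbeats 400000 in
/-- **THE CAP OF THE FLAT SHELL** (see the file header). [cite: Grafakos2014, Prop. 3.1.2 (5), Prop. 3.2.7 (3), §3.1.3] -/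
theorem sqrt_flatShell_le (hγ : P.γ = 8) (hδ₀ : 0 < P.δ₀) (hd : P.d = 2) (hN₀ : P.N₀ = 1) (hρN : P.ρN = 2)
    (a b : ℕ → UnitAddTorus (Fin 2) → ℝ) (has : ∀ j, IsSmooth (a j)) (h0 : a 0 = datum)
    (hb : ∀ j, b j = a j ∘ shearMap 0 1 (amp ⟨P.U j, P.U_periodic j, P.contDiff_U (P.δ_pos hδ₀ (by rw [hd]; norm_num) j)⟩ P.γ))
    (hab : ∀ j, a (j + 1) = b j ∘ shearMap 1 0 (amp ⟨P.U j, P.U_periodic j, P.contDiff_U (P.δ_pos hδ₀ (by rw [hd]; norm_num) j)⟩ P.γ))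
    {X Y : ℕ} (hX : 1500 ≤ X) (hY : 50 ≤ Y) (hYX : (Y - 1) * 3 ≤ 1 * (2 * X / 15)) {ε : ℝ} (hε : 0 < ε) (i : ℕ)
    (hMδA : max 1 (Real.sqrt (2 * Real.log (1 / (ε / (159 * π * 8 * 2 ^ 20 * ((2 * X / 15 : ℕ) : ℝ)) * (1 / 64) ^ i)))) * P.δ i
      < π / 2)
    (hMδB : max 1 (Real.sqrt (2 * Real.log (1 / (ε / (159 * π * 8 * 2 ^ 20 * (Y : ℝ)) * (1 / 64) ^ i)))) * P.δ i < π / 2)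
    {𝔞 : ℝ}
    (h𝔞 : Real.sqrt (∑' k : Fin 2 → ℤ, (if (Y : ℤ) ≤ |k 0| ∧ ((1 : ℕ) : ℤ) * |k 0| ≤ ((2 : ℕ) : ℤ) * |k 1| then (1 : ℝ) else 0) *
        ‖mFourierCoeff (fun x => (a i x : ℂ)) k‖ ^ 2) ≤ 𝔞) :
    Real.sqrt (∑' k : Fin 2 → ℤ, (if (X : ℤ) ≤ |k 0| ∧ ((2 : ℕ) : ℤ) * |k 0| ≤ ((15 : ℕ) : ℤ) * |k 1| then (1 : ℝ) else 0) *
        ‖mFourierCoeff (fun x => (a (i + 1) x : ℂ)) k‖ ^ 2) ≤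
      Real.sqrt (3 * 12 ^ 2 *
            (4 / 3 * ε ^ 2 + 4 / 3 * (2 * 2 ^ i / (π * (((2 * X / 15 : ℕ) : ℝ) / 10))) ^ 2 + 8 * 2 ^ i * 159 / (π * (((2 * X / 15 : ℕ) : ℝ) / 10)) +
              ((7 * i + 20 : ℕ) : ℝ) * (8 * 2 ^ i * 159 ^ 2 *
                Real.sqrt (4 * (max 1 (Real.sqrt (2 * Real.log (1 / (ε / (159 * π * 8 * 2 ^ 20 * ((2 * X / 15 : ℕ) : ℝ)) * (1 / 64) ^ i)))) * P.δ i) /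
                  (π * (((2 * X / 15 : ℕ) : ℝ) / 10))) +
                8 * 159 ^ 2 * (max 1 (Real.sqrt (2 * Real.log (1 / (ε / (159 * π * 8 * 2 ^ 20 * ((2 * X / 15 : ℕ) : ℝ)) * (1 / 64) ^ i)))) * P.δ i) / π))) +
        Real.sqrt (3 * (10 / 3) ^ 2 *
            (4 / 3 * ε ^ 2 + 4 / 3 * (2 * 2 ^ i / (π * ((Y : ℝ) / 10))) ^ 2 + 8 * 2 ^ i * 159 / (π * ((Y : ℝ) / 10)) +
              ((7 * i + 20 : ℕ) : ℝ) * (8 * 2 ^ i * 159 ^ 2 *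
                Real.sqrt (4 * (max 1 (Real.sqrt (2 * Real.log (1 / (ε / (159 * π * 8 * 2 ^ 20 * (Y : ℝ)) * (1 / 64) ^ i)))) * P.δ i) / (π * ((Y : ℝ) / 10))) +
                8 * 159 ^ 2 * (max 1 (Real.sqrt (2 * Real.log (1 / (ε / (159 * π * 8 * 2 ^ 20 * (Y : ℝ)) * (1 / 64) ^ i)))) * P.δ i) / π))) + 𝔞 +
        Real.sqrt (((1 + P.γ) ^ (2 * i) / ((Y * 2 ^ (7 * i + 20) : ℕ) : ℝ)) ^ 2) +
        Real.sqrt (((1 + P.γ) ^ (2 * (i + 1)) / (((2 * X / 15) * 2 ^ (7 * i + 20) : ℕ) : ℝ)) ^ 2) := by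
  have hA := flatShell_vstep_osc_le P hγ hδ₀ hd hN₀ hρN a b has h0 hb hab hX hYX hε i hMδA
  have hB := flatShallow_hstep_osc_le P hγ hδ₀ hd hN₀ hρN a b has h0 hb hab hY hε i hMδB
  have hI0 : ∀ (q : (Fin 2 → ℤ) → Prop) [DecidablePred q] (v : UnitAddTorus (Fin 2) → ℝ),
      0 ≤ ∑' k : Fin 2 → ℤ, (if q k then (1 : ℝ) else 0) * ‖mFourierCoeff (fun x => (v x : ℂ)) k‖ ^ 2 :=
    fun q _ v => tsum_nonneg fun k => mul_nonneg (by split_ifs <;> norm_num) (sq_nonneg _)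
  exact sqrt_offCone_next_le hA hB h𝔞 (hI0 _ _) (Real.sqrt_nonneg _) (Real.sqrt_nonneg _) (sq_nonneg _) (sq_nonneg _)

end Cascade

end Summit.AnomalousDissipation.AnomalousDissipation.Theorems.SawtoothPulseCascade.K1Window
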